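import Literature.Topology.FourManifolds.SolidTorusHandlebody
import Mathlib.Analysis.SpecialFunctions.ExpDeriv
import HarnessLib

/-!
# A genus-one handlebody whose boundary is a torus of revolution

Topic `Literature/Topology/FourManifolds`; companion to `SolidTorusHandlebody.lean` (same
method, same API), written for the fact seat of (g′)
`exists_marking_centralSurface_of_gkTrisection` (`TrisectionFunctorGK.lean`): the genus-`1`
case of (g′) needs a genus-`1` handlebody (`IsHandlebody 1`, `LickorishWallace.lean`) **whose
boundary is an explicit torus**, so that — through the uniqueness of genus-`g` handlebodies
(`IsHandlebody.nonempty_diffeomorph`, `HandlebodyClassification.lean`) — the boundary of every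
genus-`1` handlebody, in particular the central surface of a genus-`1` trisection, is a torus
and is marked by the surface group `S_1` (`TrisectionFunctorGKCentralSurface.lean`).  The model
`SolidTorusModel.SolidTorus` of `SolidTorusHandlebody.lean` is the sublevel set of a tilted
quartic whose boundary is not a surface of revolution; here the solid torus is round.

## Construction (everything proved; no named facts)

Let `G(x, y, z) = (x² + y² − 4)² + 16 z² − 1`, whose zero set is the torus of revolution
`{(ρ² − 4)² + 16 z² = 1}` (`ρ² = x² + y²`; the surface `quarticTorus 4 1 (1/4)` of
`Literature/Topology/Euclidean/QuarticTorus.lean`, homeomorphic to `S¹ × S¹`) and whose sublevel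
set `{G ≤ 0}` is the round solid torus about the circle `ρ = 2`, `z = 0`.  `G` is Morse–Bott,
not Morse (the core circle is critical), so we tilt it by a **positive** factor:

  `f = G · exp(k/64)`,  `k = x (12 − x² − y²)`           (`RoundSolidTorusModel.fn`).

Then `{f ≤ 0} = {G ≤ 0}` and `{f = 0} = {G = 0}` (`fn_nonpos_iff`, `fn_eq_zero_iff`), while
`df = e^{k/64} (dG + G dk/64)` and the choice `∂k/∂x = 12 − 3x² − y²`, vanishing on the core
circle exactly at `(±2, 0, 0)`, makes the critical set computable by hand
(`dfn_eq_zero_iff`): the critical points lie on the `x`-axis, at `(±2, 0, 0)` and at the (two,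
positive) roots of `Q(x) = 256 x − 3 (x² − 4)² + 3`, where `f > 0` (`fn_axisPt_pos_of_Q`).  The
Hessian on the axis is diagonal (`mhessian_axisPt`, weights `e^{k/64} · (w₀(x), w₁(x), 32)`),
nondegenerate at all critical points (`isMorse_fn`; at the roots of `Q` this uses `w₀ = (x² −
4) Q′(x)/64`, `w₁ = (4/3)(x² − 12)` and a Bézout identity between `Q` and `Q′`), of index `0` at
`(2, 0, 0)` and `1` at `(-2, 0, 0)` (`morseIndex_axisPt_two`, `morseIndex_axisPt_neg_two`,
Sylvester's law via `QuadraticForm.sigNeg_of_equiv_weightedSumSquares`).  Hence `0` is a regular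
level (`isRegularLevel_fn`), and

* `RoundSolidTorusModel.RoundSolidTorus := RegularSublevel isRegularLevel_fn`, the sublevel set
  `V = {f ≤ 0}` with the manifold-with-boundary structure of `RegularLevelSplitting.lean`, is
  compact (`{G ≤ 0}` is bounded), connected (one critical point of index `0` in `V`;
  `isConnected_preimage_Iic_of_isCompact'`, Reeb's argument with the index-`0` count localised
  to the sublevel set), orientable, and has a handle decomposition with one `0`-handle and one
  `1`-handle (`hasHandleDecomposition_roundSolidTorus`);
* **`isHandlebody_one_roundSolidTorus : IsHandlebody 1 RoundSolidTorus`**;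
* **`boundaryHomeomorph : ∂V ≃ₜ {G = 0}`** — the boundary of `V` is (the inclusion onto) the
  torus of revolution `{(x² + y² − 4)² + 16 z² = 1}` (`range_boundaryIncl`).

## References

* J. Milnor, *Morse theory*, Ann. of Math. Studies 51 (1963), §2 (nondegenerate critical points,
  index), Thm. 3.1 (regular sublevel sets) and the proof of Thm. 4.1 (Reeb). [Milnor1963]
* J. Schultens, *Introduction to 3-Manifolds*, GSM 151, AMS (2014), Def. 6.1.5, Example 6.1.9
  (the solid torus is the genus-one handlebody). [Schultens2014]
-/

open scoped Manifold ContDiff Topology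
open Set Function Filter Metric Module

noncomputable section

universe u

namespace Literature.Topology.FourManifolds

/-- Local notation: `𝔼 n` is the model Euclidean space `EuclideanSpace ℝ (Fin n)`. -/
local notation "𝔼 " n:arg => EuclideanSpace ℝ (Fin n)

namespace RoundSolidTorusModel

open SolidTorusModel

/-- `G(x,y,z) = (x² + y² − 4)² + 16 z² − 1`: its zero set is the torus of revolution
`quarticTorus 4 1 (1/4)` and `{G ≤ 0}` the round solid torus around the circle `ρ = 2`. [folklore] -/
def G (p : 𝔼 3) : ℝ := (p 0 ^ 2 + p 1 ^ 2 - 4) ^ 2 + 16 * p 2 ^ 2 - 1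

/-- The tilt exponent `k(x,y,z) = x (12 − x² − y²)`. [folklore] -/
def kf (p : 𝔼 3) : ℝ := p 0 * (12 - p 0 ^ 2 - p 1 ^ 2)

/-- The positive tilt factor `E = exp(k/64)`. [folklore] -/
def E (p : 𝔼 3) : ℝ := Real.exp (kf p / 64)

/-- `E > 0`. [folklore] -/
theorem E_pos (p : 𝔼 3) : 0 < E p := Real.exp_pos _

/-- **The Morse function** `f = G · exp(k/64)`: same zero set and sublevel set `{f ≤ 0} = {G ≤ 0}`
as `G`, but the tilt breaks the circle of minima of `G` into a minimum `(2,0,0)` and a saddle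
`(-2,0,0)`. [folklore] -/
def fn (p : 𝔼 3) : ℝ := G p * E p

/-- `m = 12 − 3x² − y² = ∂k/∂x`. [folklore] -/
def m (p : 𝔼 3) : ℝ := 12 - 3 * p 0 ^ 2 - p 1 ^ 2

/-- `A = G_x + G k_x / 64` (so that `f_x = E · A`). [folklore] -/
def A (p : 𝔼 3) : ℝ := 4 * p 0 * (p 0 ^ 2 + p 1 ^ 2 - 4) + G p * m p / 64
/-- `B = G_y + G k_y / 64` (so that `f_y = E · B`). [folklore] -/
def B (p : 𝔼 3) : ℝ := 4 * p 1 * (p 0 ^ 2 + p 1 ^ 2 - 4) - G p * p 0 * p 1 / 32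
/-- `C = G_z` (so that `f_z = E · C`). [folklore] -/
def C (p : 𝔼 3) : ℝ := 32 * p 2

/-- The differential of `f`: `df = E (A dx + B dy + C dz)`. [folklore] -/
def dfn (p : 𝔼 3) : (𝔼 3) →L[ℝ] ℝ := E p • (A p • π 0 + B p • π 1 + C p • π 2)

/-- `dfn` evaluated. [folklore] -/
@[simp] theorem dfn_apply (p v : 𝔼 3) :
    dfn p v = E p * (A p * v 0 + B p * v 1 + C p * v 2) := by
  simp [dfn, smul_eq_mul]; ring

/-- The differential of `G`. [folklore] -/
def dG (p : 𝔼 3) : (𝔼 3) →L[ℝ] ℝ :=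
  (4 * p 0 * (p 0 ^ 2 + p 1 ^ 2 - 4)) • π 0 + (4 * p 1 * (p 0 ^ 2 + p 1 ^ 2 - 4)) • π 1 +
    (32 * p 2) • π 2

/-- The differential of `k`. [folklore] -/
def dkf (p : 𝔼 3) : (𝔼 3) →L[ℝ] ℝ := m p • π 0 + (-(2 * p 0 * p 1)) • π 1

/-- `dkf` evaluated. [folklore] -/
@[simp] theorem dkf_apply (p v : 𝔼 3) : dkf p v = m p * v 0 - 2 * p 0 * p 1 * v 1 := by
  simp [dkf, smul_eq_mul]; ring

/-- `G` is differentiable with differential `dG`. [folklore] -/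
theorem hasFDerivAt_G (p : 𝔼 3) : HasFDerivAt G (dG p) p := by
  have h0 := hasFDerivAt_coord 0 p
  have h1 := hasFDerivAt_coord 1 p
  have h2 := hasFDerivAt_coord 2 p
  have h := (((((h0.pow 2).add (h1.pow 2)).sub_const 4).pow 2).add ((h2.pow 2).const_mul 16))
    |>.sub_const 1
  have h' : HasFDerivAt G _ p := h.congr_of_eventuallyEq (Eventually.of_forall fun q => rfl)
  refine h'.congr_fderiv ?_
  ext v
  simp [dG, smul_eq_mul]
  ring

/-- `k` is differentiable with differential `dkf`. [folklore] -/
theorem hasFDerivAt_kf (p : 𝔼 3) : HasFDerivAt kf (dkf p) p := by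
  have h0 := hasFDerivAt_coord 0 p
  have h1 := hasFDerivAt_coord 1 p
  have h := h0.mul (((h0.pow 2).const_sub 12).sub (h1.pow 2))
  have h' : HasFDerivAt kf _ p := h.congr_of_eventuallyEq (Eventually.of_forall fun q => rfl)
  refine h'.congr_fderiv ?_
  ext v
  simp [dkf, m, smul_eq_mul]
  ring

/-- `E` is differentiable with differential `(E/64) dk`. [folklore] -/
theorem hasFDerivAt_E (p : 𝔼 3) : HasFDerivAt E ((E p / 64) • dkf p) p := by
  have h := ((hasFDerivAt_kf p).mul_const (1 / 64 : ℝ)).exp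
  have h' : HasFDerivAt E _ p :=
    h.congr_of_eventuallyEq (Eventually.of_forall fun q => by
      show E q = Real.exp (kf q * (1 / 64))
      rw [E, div_eq_mul_one_div])
  refine h'.congr_fderiv ?_
  ext v
  simp only [E]
  rw [div_eq_mul_one_div (kf p)]
  simp [smul_eq_mul]
  ring

/-- `f` is differentiable with differential `dfn`. [folklore] -/
theorem hasFDerivAt_fn (p : 𝔼 3) : HasFDerivAt fn (dfn p) p := by
  have h := (hasFDerivAt_G p).mul (hasFDerivAt_E p)
  have h' : HasFDerivAt fn _ p := h.congr_of_eventuallyEq (Eventually.of_forall fun q => rfl)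
  refine h'.congr_fderiv ?_
  ext v
  simp [dfn, dG, A, B, C, m, smul_eq_mul]
  ring

/-- `fderiv f = dfn`. [folklore] -/
theorem fderiv_fn : fderiv ℝ fn = dfn := funext fun p => (hasFDerivAt_fn p).fderiv

/-- `f` is smooth. [folklore] -/
theorem contDiff_fn : ContDiff ℝ ∞ fn := by
  unfold fn G E kf
  fun_prop

/-- `Q(x) = 256 x − 3 (x² − 4)² + 3`: on the `x`-axis `A = (x² − 4) Q(x) / 64`. [folklore] -/
def Q (x : ℝ) : ℝ := 256 * x - 3 * (x ^ 2 - 4) ^ 2 + 3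

/-- `G` on the axis. [folklore] -/
theorem G_axis (x : ℝ) : G (axisPt x) = (x ^ 2 - 4) ^ 2 - 1 := by
  simp [G]

/-- `A` on the axis factors through `Q`. [folklore] -/
theorem A_axis (x : ℝ) : A (axisPt x) = (x ^ 2 - 4) * Q x / 64 := by
  simp [A, G, m, Q]; ring

/-- `B` vanishes on the axis. [folklore] -/
theorem B_axis (x : ℝ) : B (axisPt x) = 0 := by simp [B]

/-- `C` vanishes on the axis. [folklore] -/
theorem C_axis (x : ℝ) : C (axisPt x) = 0 := by simp [C]

/-- **The critical points of `f`** lie on the `x`-axis, at `x = ±2` or at the roots of `Q`. [folklore] -/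
theorem dfn_eq_zero_iff (p : 𝔼 3) :
    dfn p = 0 ↔ p 1 = 0 ∧ p 2 = 0 ∧ (p 0 ^ 2 = 4 ∨ Q (p 0) = 0) := by
  constructor
  · intro h
    have hE := (E_pos p).ne'
    have hA : A p = 0 := by
      simpa [hE] using congrArg (fun L : (𝔼 3) →L[ℝ] ℝ => L (EuclideanSpace.single 0 1)) h
    have hB : B p = 0 := by
      simpa [hE] using congrArg (fun L : (𝔼 3) →L[ℝ] ℝ => L (EuclideanSpace.single 1 1)) h
    have hC : C p = 0 := by
      simpa [hE] using congrArg (fun L : (𝔼 3) →L[ℝ] ℝ => L (EuclideanSpace.single 2 1)) h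
    simp only [A, B, C, G, m] at hA hB hC
    have h2 : p 2 = 0 := by linarith
    rw [h2] at hA hB
    set u : ℝ := p 0 ^ 2 + p 1 ^ 2 with hu
    have h1 : p 1 = 0 := by
      by_contra h1
      have hs' : 128 * (u - 4) - ((u - 4) ^ 2 - 1) * p 0 = 0 := by
        have : p 1 * (128 * (u - 4) - ((u - 4) ^ 2 - 1) * p 0) = 0 := by
          linear_combination 32 * hB
        rcases mul_eq_zero.1 this with h | h
        · exact absurd h h1
        · exact h
      have hG12 : ((u - 4) ^ 2 - 1) * (12 - u) = 0 := by
        linear_combination 64 * hA + (-(2 * p 0)) * hs'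
      rcases mul_eq_zero.1 hG12 with hG | hu12
      · have hu4 : u - 4 = 0 := by
          rw [hG, zero_mul, sub_zero] at hs'
          linarith
        rw [hu4] at hG
        norm_num at hG
      · have hu12' : u = 12 := by linarith
        rw [hu12'] at hs'
        norm_num at hs'
        have hx : p 0 = 1024 / 63 := by linarith
        have : p 0 ^ 2 ≤ u := by rw [hu]; nlinarith [sq_nonneg (p 1)]
        rw [hu12', hx] at this
        norm_num at this
    refine ⟨h1, h2, ?_⟩
    rw [h1] at hA
    have hu0 : u = p 0 ^ 2 := by rw [hu, h1]; ring
    rw [hu0] at hA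
    have hfac : (p 0 ^ 2 - 4) * Q (p 0) = 0 := by
      simp only [Q]; linear_combination 64 * hA
    rcases mul_eq_zero.1 hfac with h | h
    · left; linarith
    · right; exact h
  · rintro ⟨h1, h2, h⟩
    have hp : p = axisPt (p 0) := eq_axisPt_of h1 h2
    have hA : A (axisPt (p 0)) = 0 := by
      rw [A_axis]
      rcases h with h | h
      · rw [h]; ring
      · rw [h]; ring
    rw [hp]
    ext v
    rw [dfn_apply, hA, B_axis, C_axis]
    simp

/-! #### The Hessian -/

/-- `∂A/∂x`. [folklore] -/
def Ax (p : 𝔼 3) : ℝ := 4 * (p 0 ^ 2 + p 1 ^ 2 - 4) + 8 * p 0 ^ 2 +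
  (4 * p 0 * (p 0 ^ 2 + p 1 ^ 2 - 4) * m p + G p * (-(6 * p 0))) / 64
/-- `∂A/∂y`. [folklore] -/
def Ay (p : 𝔼 3) : ℝ := 8 * p 0 * p 1 +
  (4 * p 1 * (p 0 ^ 2 + p 1 ^ 2 - 4) * m p + G p * (-(2 * p 1))) / 64
/-- `∂A/∂z`. [folklore] -/
def Az (p : 𝔼 3) : ℝ := 32 * p 2 * m p / 64
/-- `dA`. [folklore] -/
def dA (p : 𝔼 3) : (𝔼 3) →L[ℝ] ℝ := Ax p • π 0 + Ay p • π 1 + Az p • π 2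

/-- `∂B/∂x`. [folklore] -/
def Bx (p : 𝔼 3) : ℝ := 8 * p 0 * p 1 -
  (4 * p 0 * (p 0 ^ 2 + p 1 ^ 2 - 4) * p 0 * p 1 + G p * p 1) / 32
/-- `∂B/∂y`. [folklore] -/
def By (p : 𝔼 3) : ℝ := 4 * (p 0 ^ 2 + p 1 ^ 2 - 4) + 8 * p 1 ^ 2 -
  (4 * p 1 * (p 0 ^ 2 + p 1 ^ 2 - 4) * p 0 * p 1 + G p * p 0) / 32
/-- `∂B/∂z`. [folklore] -/
def Bz (p : 𝔼 3) : ℝ := -(32 * p 2 * p 0 * p 1) / 32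
/-- `dB`. [folklore] -/
def dB (p : 𝔼 3) : (𝔼 3) →L[ℝ] ℝ := Bx p • π 0 + By p • π 1 + Bz p • π 2

/-- `dC`. [folklore] -/
def dC (_p : 𝔼 3) : (𝔼 3) →L[ℝ] ℝ := (32 : ℝ) • π 2

/-- `dA` evaluated. [folklore] -/
@[simp] theorem dA_apply (p v : 𝔼 3) : dA p v = Ax p * v 0 + Ay p * v 1 + Az p * v 2 := by
  simp [dA, smul_eq_mul]

/-- `dB` evaluated. [folklore] -/
@[simp] theorem dB_apply (p v : 𝔼 3) : dB p v = Bx p * v 0 + By p * v 1 + Bz p * v 2 := by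
  simp [dB, smul_eq_mul]

/-- `dC` evaluated. [folklore] -/
@[simp] theorem dC_apply (p v : 𝔼 3) : dC p v = 32 * v 2 := by
  simp [dC, smul_eq_mul]

/-- `m` is differentiable. [folklore] -/
theorem hasFDerivAt_m (p : 𝔼 3) :
    HasFDerivAt m ((-(6 * p 0)) • π 0 + (-(2 * p 1)) • π 1) p := by
  have h0 := hasFDerivAt_coord 0 p
  have h1 := hasFDerivAt_coord 1 p
  have h := (((h0.pow 2).const_mul 3).const_sub 12).sub (h1.pow 2)
  have h' : HasFDerivAt m _ p := h.congr_of_eventuallyEq (Eventually.of_forall fun q => rfl)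
  refine h'.congr_fderiv ?_
  ext v
  simp [smul_eq_mul]
  ring

/-- `A` is differentiable with differential `dA`. [folklore] -/
theorem hasFDerivAt_A (p : 𝔼 3) : HasFDerivAt A (dA p) p := by
  have h0 := hasFDerivAt_coord 0 p
  have h1 := hasFDerivAt_coord 1 p
  have h := (((h0.const_mul 4).mul (((h0.pow 2).add (h1.pow 2)).sub_const 4))).add
    ((((hasFDerivAt_G p).mul (hasFDerivAt_m p))).mul_const (1 / 64 : ℝ))
  have h' : HasFDerivAt A _ p :=
    h.congr_of_eventuallyEq (Eventually.of_forall fun q => by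
      show A q = _
      simp only [A, Pi.add_apply, Pi.mul_apply]
      ring)
  refine h'.congr_fderiv ?_
  ext v
  simp [dA, dG, Ax, Ay, Az, smul_eq_mul]
  ring

/-- `B` is differentiable with differential `dB`. [folklore] -/
theorem hasFDerivAt_B (p : 𝔼 3) : HasFDerivAt B (dB p) p := by
  have h0 := hasFDerivAt_coord 0 p
  have h1 := hasFDerivAt_coord 1 p
  have h := (((h1.const_mul 4).mul (((h0.pow 2).add (h1.pow 2)).sub_const 4))).sub
    ((((hasFDerivAt_G p).mul h0).mul h1).mul_const (1 / 32 : ℝ))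
  have h' : HasFDerivAt B _ p :=
    h.congr_of_eventuallyEq (Eventually.of_forall fun q => by
      show B q = _
      simp only [B, Pi.add_apply, Pi.sub_apply, Pi.mul_apply]
      ring)
  refine h'.congr_fderiv ?_
  ext v
  simp [dB, dG, Bx, By, Bz, smul_eq_mul]
  ring

/-- `C` is differentiable with differential `dC`. [folklore] -/
theorem hasFDerivAt_C (p : 𝔼 3) : HasFDerivAt C (dC p) p := by
  have h2 := hasFDerivAt_coord 2 p
  have h := h2.const_mul 32
  have h' : HasFDerivAt C _ p := h.congr_of_eventuallyEq (Eventually.of_forall fun q => rfl)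
  refine h'.congr_fderiv ?_
  ext v
  simp [dC, smul_eq_mul]

/-- The differential of `f_x = E A`. [folklore] -/
def dfA (p : 𝔼 3) : (𝔼 3) →L[ℝ] ℝ := E p • ((A p / 64) • dkf p + dA p)
/-- The differential of `f_y = E B`. [folklore] -/
def dfB (p : 𝔼 3) : (𝔼 3) →L[ℝ] ℝ := E p • ((B p / 64) • dkf p + dB p)
/-- The differential of `f_z = E C`. [folklore] -/
def dfC (p : 𝔼 3) : (𝔼 3) →L[ℝ] ℝ := E p • ((C p / 64) • dkf p + dC p)

/-- `dfA` evaluated. [folklore] -/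
@[simp] theorem dfA_apply (p v : 𝔼 3) :
    dfA p v = E p * (A p / 64 * dkf p v + dA p v) := by
  simp [dfA, smul_eq_mul]; ring

/-- `dfB` evaluated. [folklore] -/
@[simp] theorem dfB_apply (p v : 𝔼 3) :
    dfB p v = E p * (B p / 64 * dkf p v + dB p v) := by
  simp [dfB, smul_eq_mul]; ring

/-- `dfC` evaluated. [folklore] -/
@[simp] theorem dfC_apply (p v : 𝔼 3) :
    dfC p v = E p * (C p / 64 * dkf p v + dC p v) := by
  simp [dfC, smul_eq_mul]; ring

/-- `f_x = E A` is differentiable with differential `dfA`. [folklore] -/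
theorem hasFDerivAt_fA (p : 𝔼 3) : HasFDerivAt (fun q => E q * A q) (dfA p) p := by
  refine ((hasFDerivAt_E p).mul (hasFDerivAt_A p)).congr_fderiv ?_
  ext v
  simp [smul_eq_mul]
  ring

/-- `f_y = E B` is differentiable with differential `dfB`. [folklore] -/
theorem hasFDerivAt_fB (p : 𝔼 3) : HasFDerivAt (fun q => E q * B q) (dfB p) p := by
  refine ((hasFDerivAt_E p).mul (hasFDerivAt_B p)).congr_fderiv ?_
  ext v
  simp [smul_eq_mul]
  ring

/-- `f_z = E C` is differentiable with differential `dfC`. [folklore] -/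
theorem hasFDerivAt_fC (p : 𝔼 3) : HasFDerivAt (fun q => E q * C q) (dfC p) p := by
  refine ((hasFDerivAt_E p).mul (hasFDerivAt_C p)).congr_fderiv ?_
  ext v
  simp [smul_eq_mul]
  ring

/-- The second differential of `f`. [folklore] -/
def d2fn (p : 𝔼 3) : (𝔼 3) →L[ℝ] (𝔼 3) →L[ℝ] ℝ :=
  (dfA p).smulRight (π 0) + (dfB p).smulRight (π 1) + (dfC p).smulRight (π 2)

/-- `df` as a combination of the coordinate functionals with coefficients `E A, E B, E C`.
[folklore] -/
theorem dfn_eq : dfn = fun q => (E q * A q) • π 0 + (E q * B q) • π 1 + (E q * C q) • π 2 := by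
  funext q
  simp only [dfn, smul_add, smul_smul]

/-- `df` is differentiable with differential `d2fn`. [folklore] -/
theorem hasFDerivAt_dfn (p : 𝔼 3) : HasFDerivAt dfn (d2fn p) p := by
  rw [dfn_eq]
  exact (((hasFDerivAt_fA p).smul_const (π 0)).add ((hasFDerivAt_fB p).smul_const (π 1))).add
    ((hasFDerivAt_fC p).smul_const (π 2))

/-- The second Fréchet derivative of `f` is `d2fn`. [folklore] -/
theorem fderiv_fderiv_fn (p : 𝔼 3) : fderiv ℝ (fderiv ℝ fn) p = d2fn p := by
  rw [fderiv_fn]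
  exact (hasFDerivAt_dfn p).fderiv

/-- `d2fn` evaluated. [folklore] -/
@[simp]
theorem d2fn_apply_apply (p v w : 𝔼 3) :
    d2fn p v w = dfA p v * w 0 + dfB p v * w 1 + dfC p v * w 2 := by
  simp [d2fn, smul_eq_mul]

/-- The first Hessian weight on the axis. [folklore] -/
def w0 (x : ℝ) : ℝ := (x ^ 2 - 4) * Q x * (12 - 3 * x ^ 2) / 4096 +
  (12 * x ^ 2 - 16 + (4 * x * (x ^ 2 - 4) * (12 - 3 * x ^ 2) - 6 * x * ((x ^ 2 - 4) ^ 2 - 1)) / 64)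

/-- The second Hessian weight on the axis. [folklore] -/
def w1 (x : ℝ) : ℝ := 4 * (x ^ 2 - 4) - x * ((x ^ 2 - 4) ^ 2 - 1) / 32

/-- **The Hessian of `f` at a point of the `x`-axis** is diagonal:
`E · (w₀(x) v₀w₀ + w₁(x) v₁w₁ + 32 v₂w₂)`. [folklore] -/
theorem d2fn_axisPt (x : ℝ) (v w : 𝔼 3) :
    d2fn (axisPt x) v w =
      E (axisPt x) * (w0 x * (v 0 * w 0) + w1 x * (v 1 * w 1) + 32 * (v 2 * w 2)) := by
  rw [d2fn_apply_apply, dfA_apply, dfB_apply, dfC_apply, dA_apply, dB_apply, dC_apply, dkf_apply,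
    A_axis, B_axis, C_axis]
  simp only [Ax, Ay, Az, Bx, By, Bz, m, G, axisPt_zero, axisPt_one, axisPt_two, w0, w1]
  ring

/-! #### `f` as a Morse function on the manifold `ℝ³` -/

/-- Criticality of `f` on the model manifold `ℝ³` is the vanishing of `df`. [folklore] -/
theorem isMCriticalPt_iff (p : 𝔼 3) : IsMCriticalPt (𝓡 3) fn p ↔ dfn p = 0 := by
  rw [IsMCriticalPt, mfderiv_eq_fderiv, fderiv_fn]
  exact Iff.rfl

/-- The critical points of `f` on the manifold `ℝ³`. [folklore] -/
theorem isMCriticalPt_iff' (p : 𝔼 3) :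
    IsMCriticalPt (𝓡 3) fn p ↔ p 1 = 0 ∧ p 2 = 0 ∧ (p 0 ^ 2 = 4 ∨ Q (p 0) = 0) := by
  rw [isMCriticalPt_iff, dfn_eq_zero_iff]

/-- A critical point is an axis point `(x, 0, 0)` with `x² = 4` or `Q(x) = 0`. [folklore] -/
theorem exists_eq_axisPt_of_isMCriticalPt {p : 𝔼 3} (hp : IsMCriticalPt (𝓡 3) fn p) :
    ∃ x, p = axisPt x ∧ (x ^ 2 = 4 ∨ Q x = 0) := by
  obtain ⟨h1, h2, h⟩ := (isMCriticalPt_iff' p).1 hp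
  exact ⟨p 0, eq_axisPt_of h1 h2, h⟩

/-- **The Hessian of `f` on the model manifold `ℝ³` is the second differential.** [folklore] -/
theorem mhessian_apply (p v w : 𝔼 3) : mhessian (𝓡 3) fn p v w = d2fn p v w := by
  have h1 : writtenInExtChartAt (𝓡 3) 𝓘(ℝ, ℝ) p fn = fn := by
    ext q
    simp [writtenInExtChartAt]
  have h2 : extChartAt (𝓡 3) p p = p := by simp
  have h3 : range (𝓡 3) = univ := by simp
  change (fderivWithin ℝ (fderivWithin ℝ (writtenInExtChartAt (𝓡 3) 𝓘(ℝ, ℝ) p fn) (range (𝓡 3)))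
    (range (𝓡 3)) (extChartAt (𝓡 3) p p) v) w = _
  rw [h1, h3, h2, fderivWithin_univ, fderivWithin_univ, fderiv_fderiv_fn]

/-- The Hessian at an axis point, explicitly. [folklore] -/
theorem mhessian_axisPt (x : ℝ) (v w : 𝔼 3) :
    mhessian (𝓡 3) fn (axisPt x) v w =
      E (axisPt x) * (w0 x * (v 0 * w 0) + w1 x * (v 1 * w 1) + 32 * (v 2 * w 2)) := by
  rw [mhessian_apply, d2fn_axisPt]

/-! #### The Hessian weights at the critical points -/

/-- `w₀(2) = 515/16 > 0`. [folklore] -/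
theorem w0_two : w0 2 = 515 / 16 := by norm_num [w0, Q]
/-- `w₁(2) = 1/16 > 0`. [folklore] -/
theorem w1_two : w1 2 = 1 / 16 := by norm_num [w1]
/-- `w₀(-2) = 509/16 > 0`. [folklore] -/
theorem w0_neg_two : w0 (-2) = 509 / 16 := by norm_num [w0, Q]
/-- `w₁(-2) = -1/16 < 0`: the saddle direction at `(-2, 0, 0)` is `y`. [folklore] -/
theorem w1_neg_two : w1 (-2) = -1 / 16 := by norm_num [w1]

/-- `Q(±2) ≠ 0`, so a root `x` of `Q` has `x² ≠ 4`. [folklore] -/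
theorem sq_ne_four_of_Q {x : ℝ} (hQ : Q x = 0) : x ^ 2 ≠ 4 := by
  intro h
  have hx : x = 2 ∨ x = -2 := by
    have : (x - 2) * (x + 2) = 0 := by nlinarith
    rcases mul_eq_zero.1 this with h | h
    · left; linarith
    · right; linarith
  rcases hx with rfl | rfl <;> norm_num [Q] at hQ

/-- `Q` and `Q'` have no common root (Bézout identity with integer coefficients). [folklore] -/
theorem Q'_ne_zero_of_Q {x : ℝ} (hQ : Q x = 0) : 256 - 12 * x * (x ^ 2 - 4) ≠ 0 := by
  intro hQ'
  have key : (-262132 + 15616 * x + 49104 * x ^ 2) * Q x +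
      (801280 + 114637 * x - 3904 * x ^ 2 - 12276 * x ^ 3) * (256 - 12 * x * (x ^ 2 - 4)) =
      216923620 := by
    simp only [Q]; ring
  rw [hQ, hQ', mul_zero, mul_zero, zero_add] at key
  norm_num at key

/-- A root of `Q` is positive. [folklore] -/
theorem pos_of_Q {x : ℝ} (hQ : Q x = 0) : 0 < x := by
  simp only [Q] at hQ
  by_contra hx
  push Not at hx
  nlinarith [sq_nonneg (x ^ 2 - 4), sq_nonneg (x + 2), sq_nonneg x]

/-- A root of `Q` has `x² ≠ 12`. [folklore] -/
theorem sq_ne_twelve_of_Q {x : ℝ} (hQ : Q x = 0) : x ^ 2 ≠ 12 := by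
  intro h
  simp only [Q] at hQ
  have h64 : (x ^ 2 - 4) ^ 2 = 64 := by rw [h]; norm_num
  rw [h64] at hQ
  have hx : x = 189 / 256 := by linarith
  rw [hx] at h
  norm_num at h

/-- At a root of `Q`, `w₀ = (x² - 4) Q'(x) / 64`. [folklore] -/
theorem w0_of_Q {x : ℝ} (hQ : Q x = 0) : w0 x = (x ^ 2 - 4) * (256 - 12 * x * (x ^ 2 - 4)) / 64 := by
  have : w0 x = (x ^ 2 - 4) * Q x * (12 - 3 * x ^ 2) / 4096 +
      (2 * x * Q x + (x ^ 2 - 4) * (256 - 12 * x * (x ^ 2 - 4))) / 64 := by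
    simp only [w0, Q]; ring
  rw [this, hQ]; ring

/-- At a root of `Q`, `w₁ = (4/3)(x² - 12)`. [folklore] -/
theorem w1_of_Q {x : ℝ} (hQ : Q x = 0) : w1 x = 4 / 3 * (x ^ 2 - 12) := by
  simp only [Q] at hQ
  simp only [w1]
  linear_combination (x / 96) * hQ

/-- The Hessian weights are nonzero at every critical point. [folklore] -/
theorem w0_ne_zero {x : ℝ} (hx : x ^ 2 = 4 ∨ Q x = 0) : w0 x ≠ 0 := by
  rcases hx with h | h
  · have hx : x = 2 ∨ x = -2 := by
      have : (x - 2) * (x + 2) = 0 := by nlinarith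
      rcases mul_eq_zero.1 this with h | h
      · left; linarith
      · right; linarith
    rcases hx with rfl | rfl
    · rw [w0_two]; norm_num
    · rw [w0_neg_two]; norm_num
  · rw [w0_of_Q h]
    exact div_ne_zero (mul_ne_zero (sub_ne_zero.2 (sq_ne_four_of_Q h)) (Q'_ne_zero_of_Q h))
      (by norm_num)

/-- The Hessian weights are nonzero at every critical point. [folklore] -/
theorem w1_ne_zero {x : ℝ} (hx : x ^ 2 = 4 ∨ Q x = 0) : w1 x ≠ 0 := by
  rcases hx with h | h
  · have hx : x = 2 ∨ x = -2 := by
      have : (x - 2) * (x + 2) = 0 := by nlinarith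
      rcases mul_eq_zero.1 this with h | h
      · left; linarith
      · right; linarith
    rcases hx with rfl | rfl
    · rw [w1_two]; norm_num
    · rw [w1_neg_two]; norm_num
  · rw [w1_of_Q h]
    exact mul_ne_zero (by norm_num) (sub_ne_zero.2 (sq_ne_twelve_of_Q h))

/-- The Hessian at the critical points is nondegenerate. [folklore] -/
theorem nondegenerate_mhessian_axisPt {x : ℝ} (hx : x ^ 2 = 4 ∨ Q x = 0) :
    (mhessian (𝓡 3) fn (axisPt x)).Nondegenerate := by
  have hE := (E_pos (axisPt x)).ne'
  refine nondegenerate_of_diag (a := E (axisPt x) * w0 x) (b := E (axisPt x) * w1 x)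
    (c := E (axisPt x) * 32) (mul_ne_zero hE (w0_ne_zero hx)) (mul_ne_zero hE (w1_ne_zero hx))
    (mul_ne_zero hE (by norm_num)) fun v w => ?_
  rw [mhessian_axisPt]
  ring

/-- **`f` is a Morse function on `ℝ³`.** [folklore] -/
theorem isMorse_fn : IsMorse (𝓡 3) fn := by
  refine ⟨contDiff_fn.contMDiff, fun p hp => ?_⟩
  obtain ⟨x, rfl, hx⟩ := exists_eq_axisPt_of_isMCriticalPt hp
  exact nondegenerate_mhessian_axisPt hx

/-! #### Morse indices at `(±2, 0, 0)` (Sylvester) -/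

/-- The quadratic form of the Hessian at an axis point is a weighted sum of squares. [folklore] -/
theorem equivalent_weightedSumSquares_axisPt (x : ℝ) :
    QuadraticMap.Equivalent (mhessian (𝓡 3) fn (axisPt x)).toQuadraticMap
      (QuadraticMap.weightedSumSquares ℝ
        ![E (axisPt x) * w0 x, E (axisPt x) * w1 x, E (axisPt x) * 32]) := by
  refine ⟨{ toLinearEquiv := (WithLp.linearEquiv 2 ℝ (Fin 3 → ℝ)), map_app' := fun v => ?_ }⟩
  rw [QuadraticMap.weightedSumSquares_apply, LinearMap.BilinMap.toQuadraticMap_apply,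
    mhessian_axisPt]
  simp [Fin.sum_univ_three, smul_eq_mul]
  ring

/-- The Morse index at an axis critical point is the number of negative weights. [folklore] -/
theorem morseIndex_axisPt (x : ℝ) :
    morseIndex (𝓡 3) fn (axisPt x) =
      {i : Fin 3 | (![E (axisPt x) * w0 x, E (axisPt x) * w1 x, E (axisPt x) * 32] : Fin 3 → ℝ) i
        < 0}.ncard := by
  unfold morseIndex
  exact QuadraticForm.sigNeg_of_equiv_weightedSumSquares (equivalent_weightedSumSquares_axisPt x)

/-- **The critical point `(2, 0, 0)` is a minimum (index `0`).** [folklore] -/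
theorem morseIndex_axisPt_two : morseIndex (𝓡 3) fn (axisPt 2) = 0 := by
  rw [morseIndex_axisPt]
  have hE := E_pos (axisPt 2)
  have : {i : Fin 3 | (![E (axisPt 2) * w0 2, E (axisPt 2) * w1 2, E (axisPt 2) * 32] :
      Fin 3 → ℝ) i < 0} = ∅ := by
    ext i
    fin_cases i
    · simp [w0_two]; positivity
    · simp [w1_two]; positivity
    · simp; positivity
  rw [this, ncard_empty]

/-- **The critical point `(-2, 0, 0)` is a saddle of index `1`.** [folklore] -/
theorem morseIndex_axisPt_neg_two : morseIndex (𝓡 3) fn (axisPt (-2)) = 1 := by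
  rw [morseIndex_axisPt]
  have hE := E_pos (axisPt (-2))
  have : {i : Fin 3 | (![E (axisPt (-2)) * w0 (-2), E (axisPt (-2)) * w1 (-2),
      E (axisPt (-2)) * 32] : Fin 3 → ℝ) i < 0} = {1} := by
    ext i
    fin_cases i
    · simp [w0_neg_two]; positivity
    · simp [w1_neg_two]; linarith
    · simp; positivity
  rw [this, ncard_singleton]

/-! #### Values of `f` and the regular level `0` -/

/-- `f` on the axis. [folklore] -/
theorem fn_axisPt (x : ℝ) : fn (axisPt x) = ((x ^ 2 - 4) ^ 2 - 1) * E (axisPt x) := by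
  rw [fn, G_axis]

/-- `f(2, 0, 0) < 0`. [folklore] -/
theorem fn_axisPt_two_neg : fn (axisPt 2) < 0 := by
  rw [fn_axisPt]; have := E_pos (axisPt 2); nlinarith

/-- `f(-2, 0, 0) < 0`. [folklore] -/
theorem fn_axisPt_neg_two_neg : fn (axisPt (-2)) < 0 := by
  rw [fn_axisPt]; have := E_pos (axisPt (-2)); nlinarith

/-- At the other critical points (roots of `Q`, which are positive) `f > 0`. [folklore] -/
theorem fn_axisPt_pos_of_Q {x : ℝ} (hQ : Q x = 0) : 0 < fn (axisPt x) := by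
  rw [fn_axisPt]
  have hx := pos_of_Q hQ
  have hG : (x ^ 2 - 4) ^ 2 - 1 = 256 * x / 3 := by simp only [Q] at hQ; linarith
  rw [hG]
  exact mul_pos (by positivity) (E_pos _)

/-- A critical point has `f ≠ 0`; indeed `f < 0` at `(±2,0,0)` and `f > 0` at the others.
[folklore] -/
theorem fn_ne_zero_of_isMCriticalPt {p : 𝔼 3} (hp : IsMCriticalPt (𝓡 3) fn p) : fn p ≠ 0 := by
  obtain ⟨x, rfl, hx | hx⟩ := exists_eq_axisPt_of_isMCriticalPt hp
  · have hx' : x = 2 ∨ x = -2 := by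
      have : (x - 2) * (x + 2) = 0 := by nlinarith
      rcases mul_eq_zero.1 this with h | h
      · left; linarith
      · right; linarith
    rcases hx' with rfl | rfl
    · exact fn_axisPt_two_neg.ne
    · exact fn_axisPt_neg_two_neg.ne
  · exact (fn_axisPt_pos_of_Q hx).ne'

/-- **`0` is a regular level of `f`.** [folklore] -/
theorem isRegularLevel_fn : IsRegularLevel (𝓡 3) fn 0 :=
  isMorse_fn.isRegularLevel fun _ hz => fn_ne_zero_of_isMCriticalPt hz

/-- `f ≤ 0 ↔ G ≤ 0` (the tilt factor is positive). [folklore] -/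
theorem fn_nonpos_iff (p : 𝔼 3) : fn p ≤ 0 ↔ G p ≤ 0 := by
  rw [fn]
  have := E_pos p
  constructor
  · intro h; nlinarith
  · intro h; nlinarith

/-- `f = 0 ↔ G = 0`. [folklore] -/
theorem fn_eq_zero_iff (p : 𝔼 3) : fn p = 0 ↔ G p = 0 := by
  rw [fn, mul_eq_zero, or_iff_left (E_pos p).ne']

/-- A priori bound: on `{f ≤ 0}` one has `‖p‖² ≤ 6`. [folklore] -/
theorem norm_sq_le_of_fn_le {p : 𝔼 3} (h : fn p ≤ 0) : p 0 ^ 2 + p 1 ^ 2 + p 2 ^ 2 ≤ 6 := by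
  rw [fn_nonpos_iff] at h
  simp only [G] at h
  nlinarith [sq_nonneg (p 0 ^ 2 + p 1 ^ 2 - 4), sq_nonneg (p 2), sq_nonneg (p 0), sq_nonneg (p 1)]

/-- **`{f ≤ 0}` is compact** (closed and bounded in `ℝ³`). [folklore] -/
theorem isCompact_preimage_fn : IsCompact (fn ⁻¹' Iic (0 : ℝ)) := by
  refine Metric.isCompact_of_isClosed_isBounded (isClosed_Iic.preimage contDiff_fn.continuous) ?_
  rw [isBounded_iff_forall_norm_le]
  refine ⟨3, fun p hp => ?_⟩
  have h := norm_sq_le_of_fn_le (p := p) hp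
  have hn : ‖p‖ ^ 2 = p 0 ^ 2 + p 1 ^ 2 + p 2 ^ 2 := by
    rw [EuclideanSpace.norm_sq_eq, Fin.sum_univ_three]
    simp [Real.norm_eq_abs, sq_abs]
  nlinarith [norm_nonneg p]

end RoundSolidTorusModel



/-! ### Connectedness of compact sublevel sets, localised index-`0` hypothesis -/

section Connected

variable {k : ℕ} {M : Type u} [TopologicalSpace M] [ChartedSpace (𝔼 (k + 1)) M] {f : M → ℝ} {a : ℝ}

/-- **A compact nonempty sublevel set `{f ≤ a}` of a `C²` function containing at most one
critical point of index `0` is connected**: the variant of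
`isConnected_preimage_Iic_of_isCompact` (`SolidTorusHandlebody.lean`) in which only the
index-`0` critical points *inside* `{f ≤ a}` are counted — same proof (Reeb's argument, Milnor,
*Morse theory* (1963), proof of Thm. 4.1: two closed pieces would carry two minima of `f` on
`{f ≤ a}`, both critical of index `0`). [cite: Milnor1963, §3 and proof of Thm. 4.1] -/
theorem isConnected_preimage_Iic_of_isCompact' (hf : ContMDiff (𝓡 (k + 1)) 𝓘(ℝ, ℝ) 2 f)
    (hK : IsCompact (f ⁻¹' Iic a))
    (h0 : (criticalSetOfIndex (𝓡 (k + 1)) f 0 ∩ f ⁻¹' Iic a).Subsingleton)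
    (hne : (f ⁻¹' Iic a).Nonempty) : IsConnected (f ⁻¹' Iic a) := by
  refine ⟨hne, ?_⟩
  rw [isPreconnected_iff_subset_of_disjoint_closed]
  intro u v hu hv huv hdisj
  by_contra hcon
  rw [not_or] at hcon
  obtain ⟨hSu, hSv⟩ := hcon
  obtain ⟨xv, hxvS, hxvu⟩ := not_subset.1 hSu
  obtain ⟨xu, hxuS, hxuv⟩ := not_subset.1 hSv
  have hxv : xv ∈ v := (huv hxvS).resolve_left hxvu
  have hxu : xu ∈ u := (huv hxuS).resolve_right hxuv
  have key : ∀ (u v : Set M), IsClosed u → IsClosed v → f ⁻¹' Iic a ⊆ u ∪ v →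
      f ⁻¹' Iic a ∩ (u ∩ v) = ∅ → (f ⁻¹' Iic a ∩ u).Nonempty →
      ∃ m ∈ f ⁻¹' Iic a ∩ u, m ∈ criticalSetOfIndex (𝓡 (k + 1)) f 0 := by
    intro u v hu hv huv hdisj hne
    obtain ⟨m, hm, hmin⟩ := (hK.inter_right hu).exists_isMinOn hne hf.continuous.continuousOn
    have hloc : IsLocalMin f m := isLocalMin_of_isMinOn_piece hv huv hdisj hm hmin
    exact ⟨m, hm, IsLocalMin.isMCriticalPt hloc, IsLocalMin.morseIndex_eq_zero (hf m) hloc⟩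
  obtain ⟨m, hm, hmc⟩ := key u v hu hv huv hdisj ⟨xu, hxuS, hxu⟩
  obtain ⟨m', hm', hm'c⟩ := key v u hv hu (by rwa [union_comm]) (by rwa [inter_comm v u])
    ⟨xv, hxvS, hxv⟩
  have hmm' : m = m' := h0 ⟨hmc, hm.1⟩ ⟨hm'c, hm'.1⟩
  have : m ∈ f ⁻¹' Iic a ∩ (u ∩ v) := ⟨hm.1, hm.2, hmm' ▸ hm'.2⟩
  rw [hdisj] at this
  exact this

/-- `Mᵃ` is connected when `{f ≤ a}` is compact and nonempty and contains at most one critical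
point of `f` (`C²`) of index `0`. [cite: Milnor1963, §3 and proof of Thm. 4.1] -/
theorem RegularSublevel.connectedSpace_of_isCompact' (h : IsRegularLevel (𝓡 (k + 1)) f a)
    (hK : IsCompact (f ⁻¹' Iic a))
    (h0 : (criticalSetOfIndex (𝓡 (k + 1)) f 0 ∩ f ⁻¹' Iic a).Subsingleton)
    (hne : ∃ x, f x ≤ a) : ConnectedSpace (RegularSublevel h) :=
  isConnected_iff_connectedSpace.1
    (isConnected_preimage_Iic_of_isCompact' (h.contMDiff.of_le (by norm_cast)) hK h0 hne)

end Connected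

namespace RoundSolidTorusModel

open SolidTorusModel

/-! #### The round solid torus `V = {f ≤ 0} = {G ≤ 0}` -/

/-- A critical point of `f` in `{f ≤ 0}` is `(2, 0, 0)` or `(-2, 0, 0)`. [folklore] -/
theorem eq_of_isMCriticalPt_of_fn_nonpos {p : 𝔼 3} (hp : IsMCriticalPt (𝓡 3) fn p)
    (hle : fn p ≤ 0) : p = axisPt 2 ∨ p = axisPt (-2) := by
  obtain ⟨x, rfl, hx | hx⟩ := exists_eq_axisPt_of_isMCriticalPt hp
  · have : (x - 2) * (x + 2) = 0 := by nlinarith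
    rcases mul_eq_zero.1 this with h | h
    · left; congr 1; linarith
    · right; congr 1; linarith
  · exact absurd hle (not_le.2 (fn_axisPt_pos_of_Q hx))

/-- **The critical points of `f` of each index inside `{f ≤ 0}`**: the minimum `(2,0,0)` and the
saddle `(-2,0,0)`. [folklore] -/
theorem criticalSetOfIndex_inter (i : ℕ) :
    criticalSetOfIndex (𝓡 3) fn i ∩ fn ⁻¹' Iic (0 : ℝ) =
      if i = 0 then {axisPt 2} else if i = 1 then {axisPt (-2)} else ∅ := by
  ext p
  simp only [mem_inter_iff, mem_criticalSetOfIndex, mem_preimage, mem_Iic]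
  constructor
  · rintro ⟨⟨hp, hi⟩, hle⟩
    rcases eq_of_isMCriticalPt_of_fn_nonpos hp hle with rfl | rfl
    · rw [morseIndex_axisPt_two] at hi; subst hi; simp
    · rw [morseIndex_axisPt_neg_two] at hi; subst hi; simp
  · intro hp
    split_ifs at hp with h0 h1
    · subst h0; rw [mem_singleton_iff] at hp; subst hp
      exact ⟨⟨(isMCriticalPt_iff' _).2 (by simp; norm_num), morseIndex_axisPt_two⟩, fn_axisPt_two_neg.le⟩
    · subst h1; rw [mem_singleton_iff] at hp; subst hp
      exact ⟨⟨(isMCriticalPt_iff' _).2 (by simp; norm_num), morseIndex_axisPt_neg_two⟩,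
        fn_axisPt_neg_two_neg.le⟩
    · exact absurd hp (notMem_empty _)

/-- **The round solid torus** `V = {f ≤ 0} = {(x² + y² - 4)² + 16 z² ≤ 1} ⊂ ℝ³`, a regular
sublevel set of the Morse function `f` (`RegularSublevel`: a smooth compact `3`-manifold with
boundary the torus of revolution `{(x² + y² - 4)² + 16 z² = 1}`). [folklore] -/
abbrev RoundSolidTorus : Type := RegularSublevel isRegularLevel_fn

/-- `V` is compact. [folklore] -/
instance : CompactSpace RoundSolidTorus :=
  RegularSublevel.compactSpace_of_isCompact _ isCompact_preimage_fn

/-- `V` is connected (one critical point of index `0` in `V`). [folklore] -/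
instance : ConnectedSpace RoundSolidTorus :=
  RegularSublevel.connectedSpace_of_isCompact' _ isCompact_preimage_fn
    (by rw [criticalSetOfIndex_inter]; exact subsingleton_singleton)
    ⟨axisPt 2, fn_axisPt_two_neg.le⟩

/-- `V` is orientable (a codimension-`0` submanifold of `ℝ³`). [folklore] -/
theorem isOrientable_roundSolidTorus : IsOrientable (𝓡∂ 3) RoundSolidTorus :=
  RegularSublevel.isOrientable _ (isOrientable_euclideanSpace 3)

/-- The handle count of `V`: one `0`-handle, one `1`-handle, nothing else. [folklore] -/
theorem ncard_criticalSetOfIndex_inter (i : ℕ) :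
    (criticalSetOfIndex (𝓡 3) fn i ∩ fn ⁻¹' Iic (0 : ℝ)).ncard = handleCount 1 1 i := by
  rw [criticalSetOfIndex_inter]
  rcases Nat.lt_or_ge i 2 with hi | hi
  · interval_cases i <;> simp [handleCount]
  · have h0 : i ≠ 0 := by omega
    have h1 : i ≠ 1 := by omega
    simp [h0, h1, handleCount]

/-- **`V` has a handle decomposition with one `0`-handle and one `1`-handle** (the Morse function
`f|V + 1`). [folklore] -/
theorem hasHandleDecomposition_roundSolidTorus :
    HasHandleDecomposition 2 RoundSolidTorus (handleCount 1 1) := by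
  have hd := RegularSublevel.hasHandleDecomposition isMorse_fn isRegularLevel_fn
  have hfun : (fun i => (criticalSetOfIndex (𝓡 3) fn i ∩ fn ⁻¹' Iic (0 : ℝ)).ncard) =
      handleCount 1 1 := funext ncard_criticalSetOfIndex_inter
  rw [hfun] at hd
  exact hd

/-- **The round solid torus `V ⊂ ℝ³` is a genus-`1` handlebody** (`IsHandlebody`: compact,
connected, orientable, one `0`-handle and one `1`-handle; Schultens, *Introduction to
3-Manifolds* (2014), Def. 6.1.5 and Example 6.1.9). [cite: Schultens2014, Def. 6.1.5] -/
theorem isHandlebody_one_roundSolidTorus : IsHandlebody 1 RoundSolidTorus :=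
  ⟨inferInstance, inferInstance, isOrientable_roundSolidTorus,
    hasHandleDecomposition_roundSolidTorus⟩

/-! #### The boundary of `V` is the torus of revolution `{G = 0}` -/

/-- A point of `V` is a boundary point iff it lies on the torus `{G = 0}`. [folklore] -/
theorem mem_boundary_iff (z : RoundSolidTorus) :
    z ∈ (𝓡∂ 3).boundary RoundSolidTorus ↔ G (RegularSublevel.incl isRegularLevel_fn z) = 0 := by
  rw [RegularSublevel.mem_boundary_iff, fn_eq_zero_iff]

/-- The inclusion of `∂V` in `ℝ³`. [folklore] -/
def boundaryIncl (z : (𝓡∂ 3).boundary RoundSolidTorus) : 𝔼 3 :=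
  RegularSublevel.incl isRegularLevel_fn z.1

/-- The inclusion `∂V → ℝ³` is a topological embedding. [folklore] -/
theorem isEmbedding_boundaryIncl : Topology.IsEmbedding boundaryIncl :=
  (RegularSublevel.isEmbedding_incl isRegularLevel_fn).comp Topology.IsEmbedding.subtypeVal

/-- **The boundary of `V` is (embeds onto) the torus of revolution**
`{(x² + y² - 4)² + 16 z² = 1}`. [folklore] -/
theorem range_boundaryIncl : range boundaryIncl = {p | G p = 0} := by
  ext p
  constructor
  · rintro ⟨z, rfl⟩
    exact (mem_boundary_iff z.1).1 z.2
  · intro hp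
    have hle : fn p ≤ 0 := ((fn_eq_zero_iff p).2 hp).le
    refine ⟨⟨RegularSublevel.mk isRegularLevel_fn p hle, ?_⟩, rfl⟩
    rw [mem_boundary_iff]
    exact hp

/-- **`∂V ≃ₜ {G = 0}`**: the boundary of the round solid torus is homeomorphic to the torus of
revolution `{(x² + y² - 4)² + 16 z² = 1} ⊂ ℝ³`. [folklore] -/
def boundaryHomeomorph : ↥((𝓡∂ 3).boundary RoundSolidTorus) ≃ₜ {p : 𝔼 3 | G p = 0} :=
  isEmbedding_boundaryIncl.toHomeomorph.trans (Homeomorph.setCongr range_boundaryIncl)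

/-- The homeomorphism `∂V ≃ₜ {G = 0}` is the inclusion. [folklore] -/
@[simp] theorem boundaryHomeomorph_apply_coe (z : (𝓡∂ 3).boundary RoundSolidTorus) :
    (boundaryHomeomorph z : 𝔼 3) = RegularSublevel.incl isRegularLevel_fn z.1 := rfl

end RoundSolidTorusModel

end Literature.Topology.FourManifolds
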